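import Summits.BirchSwinnertonDyer.Rank1Residual.Additive.PadicLayerTransport
import Summits.BirchSwinnertonDyer.Rank1Residual.Additive.KobayashiHondaPoints
import HarnessLib

/-!
# Kobayashi's points `c_m ∈ E₁(ℚ_p(ζ_{p^m}))` inside `E(ℚ̄_p)`: coordinates in the layer, the values
# `Λ(c_m) = ℓ_m = ∑_{k<m} (−1)ᵏ(ζ_{p^{m−2k}} − 1)/pᵏ`, the TRACE IDENTITY
# `∑_{Gal(k_m/k_{m−1})} σℓ_{m+1} = −p − ℓ_{m−1}`, and the Galois behaviour of `Λ` on layer points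
# (cell `b2b-bsdres`, CLASS-CLOSURE lane, class O10 — x1b GEN 33, class lead; file 34 of the local
# series: [K] §8.4, Lemma 8.9 `Tr_{n+1/n} c_{n+1} = −c_{n−1}`-type relation at the level of logarithms)

HONEST FRAMING (cell `b2b-bsdres`, run/shared/lean/b2b/bsd-rank1-residual/, verbatim in every
file): the goal of the cell is to DELETE the COMBINATION-SHAPED residual classes of the
Birch–Swinnerton-Dyer formula for ALL analytic-rank `≤ 1` elliptic curves over `ℚ` — "full BSD
formula for every rank `≤ 1` curve in class `C`" assembled STRICTLY from published theorems — so
that the rank-`≤ 1` remainder becomes exactly the CONSTRUCTION-SHAPED classes, which are TYPED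
(missing-input `Prop`s), NOT attempted. This is not "finishing BSD". CLASS-CLOSURE lane: prove
what is provable now; shrink each hard class to its core with data; no claim beyond stated classes;
research routes on CONSTRUCTION-SHAPED X12 / O10; census / instrument output = EVIDENCE / conjecture
items, NEVER a Literature fact; `RESIDUAL-MAP.md` marks change only by signed lines. THIS FILE:
TOOL DEFINITIONS + THEOREMS (definitions with bodies: `towerParam`, `cPt`, `ell`; every statement
proved) — no named Literature fact, no Summits-side fact `def … : Prop`, no `sorry`, axioms
standard; nothing is booked; no label / mark / count / sub-cell moves; O10 stays OPEN /
CONSTRUCTION-SHAPED; nothing about `BSD(W, p)` of any pair is claimed.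

## Content (`Ω = PadicAlgCl p`, `Γ = Gal(ℚ̄_p/ℚ_p)`, `E_Ω = (M ⊗ ℚ_p) ⊗ Ω`, `L(m)` = points with
## coordinates in `layer p m`, `E₁ = kernel`)

* §1 `cPt m = toOmega (hondaPt (ζ_m − 1))` (`= O` for `m = 0`): `∈ L(m) ∩ E₁`; `ell p m`;
  **`ptLogΩ_cPt`: `Λ(c_m) = ℓ_m`**.
* §2 **`sum_smul_ell_succ`**: `∑_{q ∈ stab m / stab (m+1)} q̃ • ℓ_{m+1} = −p − ℓ_{m−1}` (`m ≥ 1`),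
  `sum_smul_ell_one`: `= −p` for `m = 0` (file 20's trace sums).
* §3 For a coordinatewise action `act` of `Γ` on `E_Ω`-points (`act σ (x,y) = (σx, σy)`): `act`
  preserves `L(m)` and `E₁`, `Λ(act σ Q) = σ • Λ(Q)`; **`mem_subfieldPoints_of_ptLogΩ_mem`**: a point of
  `L(m) ∩ E₁` whose logarithm lies in `layer m'` (`m' ≤ m`) lies in `L(m')`, provided `L(m)` has no
  `p`-power torsion (the equivariance-plus-injectivity argument of [K] §8.4).

References: [Kobayashi2003] §8.4, Lemma 8.9, Prop. 8.11; [SilvermanAEC2009] IV.6.4.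
-/

noncomputable section

open scoped Classical Topology NNReal
open Filter PowerSeries Finset

namespace Summit.BirchSwinnertonDyer.Rank1Residual.Additive

namespace BallEval

open Literature.NumberTheory.GaloisRepresentations.LubinTate (unitBall mem_unitBall_iff)
open Literature.NumberTheory.EllipticCurves Literature.NumberTheory.EllipticCurves.FormalGroupChart
open WeierstrassCurve PadicCyclotomicTower HondaFss Field

/-- `E_Ω = (M ⊗ ℚ_p) ⊗ ℚ̄_p`, the curve over `Ω = ℚ̄_p` (reducible abbreviation). [folklore] -/
abbrev genFibΩ (p : ℕ) [Fact p.Prime] (M : WeierstrassCurve ℤ_[p]) : WeierstrassCurve (PadicAlgCl p) :=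
  (M.map (PadicInt.Coe.ringHom (p := p))).baseChange (PadicAlgCl p)

variable (p : ℕ) [hp : Fact p.Prime] (M : WeierstrassCurve ℤ_[p])
  [hE : (M.map PadicInt.Coe.ringHom).IsElliptic] [hEt : (M.map PadicInt.toZMod).IsElliptic]
  (hp2 : p ≠ 2) (htr : Literature.NumberTheory.EllipticCurves.HasseManin.tr (M.map PadicInt.toZMod) = 0)


/-! ## §1 The points `c_m` and their logarithms -/

/-- **The parameter `ζ_m − 1 ∈ 𝒪_{K_m}`.** [cite: Kobayashi2003, §8.4] -/
def towerParam (m : ℕ) : unitBall (LayerField p m) :=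
  ⟨LayerField.mk p m (zeta p m - 1) (IntermediateField.sub_mem _ (zeta_mem_layer p m) (IntermediateField.one_mem _)),
    (mem_unitBall_iff _).mpr (by rw [← LayerField.norm_emb, LayerField.emb_mk]; exact norm_zeta_sub_one_le_one p m)⟩

variable {p} in
/-- `‖ζ_m − 1‖ < 1` (`m ≥ 1`). [folklore] -/
theorem norm_towerParam_lt_one {m : ℕ} (hm : 1 ≤ m) : ‖((towerParam p m : unitBall (LayerField p m)) : LayerField p m)‖ < 1 := by
  change ‖LayerField.mk p m (zeta p m - 1) _‖ < 1
  rw [← LayerField.norm_emb, LayerField.emb_mk]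
  exact norm_zeta_sub_one_lt_one p hm

variable {p} in
/-- `emb (ζ_m − 1) = ζ_m − 1`. [folklore] -/
theorem emb_towerParam (m : ℕ) :
    LayerField.emb p m ((towerParam p m : unitBall (LayerField p m)) : LayerField p m) = zeta p m - 1 := rfl

/-- **Kobayashi's point `c_m ∈ E(ℚ̄_p)`** (the Honda point of `ζ_m − 1`, embedded; `O` for `m = 0`).
[cite: Kobayashi2003, §8.4] -/
def cPt (m : ℕ) : (genFibΩ p M).toAffine.Point :=
  if hm : 1 ≤ m then toOmega p M m (hondaPt p (LayerField p m) M hp2 htr (towerParam p m) (norm_towerParam_lt_one hm))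
  else 0

/-- **`ℓ_m = ∑_{k<m} (−1)ᵏ (ζ_{m−2k} − 1)/pᵏ`** (`ζ_j = zeta p j`, `ζ_0 = 1`; the terms with `2k ≥ m`
vanish). [cite: Kobayashi2003, §8.4] -/
def ell (m : ℕ) : PadicAlgCl p :=
  ∑ k ∈ range m, (-1) ^ k * (zeta p (m - 2 * k) - 1) / (p : PadicAlgCl p) ^ k

variable {p M hp2 htr}

/-- `ζ_m^{p^{2k}} = ζ_{m−2k}` (with `ζ_0 = 1` when `2k ≥ m`). [folklore] -/
theorem zeta_pow_sq_pow (m k : ℕ) : zeta p m ^ p ^ (2 * k) = zeta p (m - 2 * k) := by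
  by_cases h : 2 * k ≤ m
  · obtain ⟨j, rfl⟩ := Nat.exists_eq_add_of_le' h
    rw [Nat.add_sub_cancel, zeta_add_pow]
  · push Not at h
    rw [Nat.sub_eq_zero_of_le h.le, zeta_zero, zeta_pow_eq_one_of_le p h.le]

variable [hintΩ : (genFibΩ p M).IsIntegral (Valued.v (R := PadicAlgCl p)).integer]

omit hintΩ in
/-- `c_m` for `m ≥ 1`. [folklore] -/
theorem cPt_of_pos {m : ℕ} (hm : 1 ≤ m) :
    cPt p M hp2 htr m = toOmega p M m (hondaPt p (LayerField p m) M hp2 htr (towerParam p m) (norm_towerParam_lt_one hm)) := by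
  unfold cPt; rw [dif_pos hm]

omit hintΩ in
/-- `c_0 = O`. [folklore] -/
theorem cPt_zero : cPt p M hp2 htr 0 = 0 := by
  unfold cPt; rw [dif_neg (by omega)]

omit hintΩ in
/-- **`c_m ∈ L(m)`** (coordinates in `ℚ_p(ζ_m)`). [cite: Kobayashi2003, §8.4] -/
theorem cPt_mem_subfieldPoints (m : ℕ) : cPt p M hp2 htr m ∈ subfieldPoints (genFibΩ p M) (layer p m).toSubfield coeffs_mem_layer := by
  by_cases hm : 1 ≤ m
  · rw [cPt_of_pos hm]; exact toOmega_mem_subfieldPoints _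
  · unfold cPt; rw [dif_neg hm]; exact (subfieldPoints _ _ _).zero_mem

/-- **`c_m ∈ E₁`.** [cite: Kobayashi2003, §8.4] -/
theorem cPt_mem_kernel (m : ℕ) : cPt p M hp2 htr m ∈ kernel (Valued.v (R := PadicAlgCl p)) (genFibΩ p M) := by
  by_cases hm : 1 ≤ m
  · haveI := isIntegral_curveK p (LayerField p m) M
    rw [cPt_of_pos hm]
    exact (toOmega_mem_kernel_iff _).mpr (hondaPt_mem_kernel _)
  · unfold cPt; rw [dif_neg hm]; exact (kernel (Valued.v (R := PadicAlgCl p)) (genFibΩ p M)).zero_mem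

omit hE hEt hintΩ in
/-- `bLogΩ 0 = 0`. [folklore] -/
theorem bLogΩ_zero : bLogΩ p M 0 = 0 := by
  rw [bLogΩ]
  refine (tsum_congr fun n => ?_).trans tsum_zero
  rcases Nat.eq_zero_or_pos n with rfl | hn
  · rw [coeff_zero_eq_zero (norm_coeff_logQ_le (p := p) (M := M)), map_zero, zero_mul]
  · rw [zero_pow hn.ne', mul_zero]

omit hE hEt hintΩ in
/-- `Λ(O) = 0` on `Ω`-points. [folklore] -/
theorem ptLogΩ_zero : ptLogΩ p M (0 : (genFibΩ p M).toAffine.Point) = 0 := by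
  rw [ptLogΩ, Affine.Point.zCoord_zero, bLogΩ_zero]

omit hintΩ in
/-- `ell 0 = 0`. [folklore] -/
theorem ell_zero : ell p 0 = 0 := by rw [ell, sum_range_zero]

omit hintΩ in
/-- **`Λ(c_m) = ℓ_m`.** [cite: Kobayashi2003, §8.4, Lemma 8.9] -/
theorem ptLogΩ_cPt (m : ℕ) : ptLogΩ p M (cPt p M hp2 htr m) = ell p m := by
  by_cases hm : 1 ≤ m
  · haveI := isIntegral_curveK p (LayerField p m) M
    rw [cPt_of_pos hm, ptLogΩ_toOmega (hondaPt_mem_kernel _),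
      ptLog_hondaPt_eq_sum (k₀ := m) (norm_towerParam_lt_one hm) ?_]
    · rw [map_sum, ell]
      refine sum_congr rfl fun k _ => ?_
      rw [logFssRow]
      simp only [map_div₀, map_mul, map_pow, map_neg, map_one, map_sub, map_add, map_natCast, emb_towerParam]
      rw [add_sub_cancel, zeta_pow_sq_pow]
    · intro k hk
      apply LayerField.emb_injective
      rw [map_pow, map_add, map_one, emb_towerParam, add_sub_cancel]
      exact zeta_pow_eq_one_of_le p (by omega)
  · have h0 : m = 0 := by omega
    subst h0
    rw [cPt_zero, ptLogΩ_zero, ell_zero]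

/-! ## §2 The trace identity for `ℓ` -/

omit hE hEt hintΩ in
/-- The terms `k ≥ 1` of `ℓ_{m+1}` lie in `layer m` (indeed in `layer (m−1)`), hence are fixed by
`stab p m`. [folklore] -/
theorem smul_ell_term_of_pos {m k : ℕ} (hk : 1 ≤ k) {σ : Field.absoluteGaloisGroup ℚ_[p]} (hσ : σ ∈ stab p m) :
    σ • ((-1) ^ k * (zeta p (m + 1 - 2 * k) - 1) / (p : PadicAlgCl p) ^ k) =
      (-1) ^ k * (zeta p (m + 1 - 2 * k) - 1) / (p : PadicAlgCl p) ^ k := by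
  refine smul_eq_self_of_mem_stab hσ ?_
  have hz : zeta p (m + 1 - 2 * k) ∈ layer p m :=
    layer_mono p (by omega) (zeta_mem_layer p (m + 1 - 2 * k))
  refine div_mem (mul_mem (pow_mem (neg_mem (one_mem _)) k) (sub_mem hz (one_mem _))) (pow_mem ?_ k)
  exact_mod_cast IntermediateField.natCast_mem (layer p m) p

omit hE hEt hintΩ in
/-- `ℓ_{m+1} = (ζ_{m+1} − 1) + ∑_{1 ≤ k ≤ m} (terms in layer (m−1))`. [folklore] -/
theorem ell_succ (m : ℕ) : ell p (m + 1) = (zeta p (m + 1) - 1) +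
    ∑ k ∈ range m, (-1) ^ (k + 1) * (zeta p (m + 1 - 2 * (k + 1)) - 1) / (p : PadicAlgCl p) ^ (k + 1) := by
  rw [ell, sum_range_succ', pow_zero, one_mul, mul_zero, Nat.sub_zero, pow_zero, div_one, add_comm]

omit hE hEt hintΩ in
/-- `p · (tail of ℓ_{m+1}) = −ℓ_{m−1}` (for `m ≥ 1`): shifting `k ↦ k − 1`. [folklore] -/
theorem p_mul_tail (m : ℕ) (hm : 1 ≤ m) :
    (p : PadicAlgCl p) * ∑ k ∈ range m, (-1) ^ (k + 1) * (zeta p (m + 1 - 2 * (k + 1)) - 1) / (p : PadicAlgCl p) ^ (k + 1) =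
      -ell p (m - 1) := by
  have hp0 : (p : PadicAlgCl p) ≠ 0 := Nat.cast_ne_zero.mpr hp.out.ne_zero
  obtain ⟨m', rfl⟩ := Nat.exists_eq_add_of_le' hm
  rw [Nat.add_sub_cancel, ell, mul_sum, ← sum_neg_distrib, sum_range_succ]
  -- the last term `k = m'` vanishes: `ζ_{m'+2-2(m'+1)} = ζ_0 = 1`
  have hlast : (p : PadicAlgCl p) * ((-1) ^ (m' + 1) * (zeta p (m' + 1 + 1 - 2 * (m' + 1)) - 1) / (p : PadicAlgCl p) ^ (m' + 1)) = 0 := by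
    rw [show m' + 1 + 1 - 2 * (m' + 1) = 0 by omega, zeta_zero, sub_self, mul_zero, zero_div, mul_zero]
  rw [hlast, add_zero]
  refine sum_congr rfl fun k hk => ?_
  rw [mem_range] at hk
  rw [show m' + 1 + 1 - 2 * (k + 1) = m' - 2 * k by omega, pow_succ, pow_succ]
  field_simp

/-- **The trace identity**: for `m ≥ 1`, `∑_{q ∈ stab m / stab (m+1)} q̃ • ℓ_{m+1} = −p − ℓ_{m−1}`.
[cite: Kobayashi2003, Lemma 8.9] -/
theorem sum_smul_ell_succ {m : ℕ} (hm : 1 ≤ m)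
    [Fintype (stab p m ⧸ (stab p (m + 1)).subgroupOf (stab p m))] :
    ∑ q : stab p m ⧸ (stab p (m + 1)).subgroupOf (stab p m), ((q.out : stab p m) : Field.absoluteGaloisGroup ℚ_[p]) • ell p (m + 1) =
      -(p : PadicAlgCl p) - ell p (m - 1) := by
  simp_rw [ell_succ, smul_add, smul_sum]
  rw [sum_add_distrib, sum_out_smul_zeta_succ_sub_one, sum_comm]
  have hfix : ∀ k ∈ range m, ∑ q : stab p m ⧸ (stab p (m + 1)).subgroupOf (stab p m),
      ((q.out : stab p m) : Field.absoluteGaloisGroup ℚ_[p]) • ((-1) ^ (k + 1) * (zeta p (m + 1 - 2 * (k + 1)) - 1) / (p : PadicAlgCl p) ^ (k + 1)) =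
      (p : PadicAlgCl p) * ((-1) ^ (k + 1) * (zeta p (m + 1 - 2 * (k + 1)) - 1) / (p : PadicAlgCl p) ^ (k + 1)) := by
    intro k _
    rw [sum_out_smul_of_forall_smul_eq m fun σ hσ => smul_ell_term_of_pos (by omega) hσ,
      index_subgroupOf_stab_succ, if_neg (by omega), nsmul_eq_mul]
  rw [sum_congr rfl hfix, ← mul_sum, p_mul_tail m hm, sub_eq_add_neg]

/-- **The trace identity at the bottom**: `∑_{Γ / stab 1} q̃ • ℓ_1 = −p`. [cite: Kobayashi2003, Lemma 8.9] -/
theorem sum_smul_ell_one [Fintype (stab p 0 ⧸ (stab p 1).subgroupOf (stab p 0))] :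
    ∑ q : stab p 0 ⧸ (stab p 1).subgroupOf (stab p 0), ((q.out : stab p 0) : Field.absoluteGaloisGroup ℚ_[p]) • ell p 1 = -(p : PadicAlgCl p) := by
  have h1 : ell p 1 = zeta p 1 - 1 := by
    rw [ell, sum_range_one, pow_zero, one_mul, mul_zero, Nat.sub_zero, pow_zero, div_one]
  simp_rw [h1]
  exact sum_out_smul_zeta_succ_sub_one p 0

/-! ## §3 Galois behaviour of `Λ` on layer points -/

omit hE hEt hintΩ in
/-- `z(act σ Q) = σ • z(Q)`. [folklore] -/
theorem zCoord_act (act : Field.absoluteGaloisGroup ℚ_[p] → (genFibΩ p M).toAffine.Point → (genFibΩ p M).toAffine.Point)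
    (hact0 : ∀ σ, act σ 0 = 0)
    (hact : ∀ σ (x y : PadicAlgCl p) (h : (genFibΩ p M).toAffine.Nonsingular x y),
      ∃ h', act σ (Affine.Point.some x y h) = Affine.Point.some (σ • x) (σ • y) h')
    (σ : Field.absoluteGaloisGroup ℚ_[p]) (Q : (genFibΩ p M).toAffine.Point) : (act σ Q).zCoord = σ • Q.zCoord := by
  rcases Q with _ | ⟨x, y, h⟩
  · rw [show (Affine.Point.zero : (genFibΩ p M).toAffine.Point) = 0 from rfl, hact0, Affine.Point.zCoord_zero,
      smul_zero]
  · obtain ⟨h', e⟩ := hact σ x y h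
    rw [e, Affine.Point.zCoord_some, Affine.Point.zCoord_some, Field.absoluteGaloisGroup.smul_def σ x,
      Field.absoluteGaloisGroup.smul_def σ y, Field.absoluteGaloisGroup.smul_def σ (-x / y), map_div₀, map_neg]

omit hE hEt hintΩ in
/-- `act σ` preserves the layer points `L(m)`. [folklore] -/
theorem act_mem_subfieldPoints (act : Field.absoluteGaloisGroup ℚ_[p] → (genFibΩ p M).toAffine.Point → (genFibΩ p M).toAffine.Point)
    (hact0 : ∀ σ, act σ 0 = 0)
    (hact : ∀ σ (x y : PadicAlgCl p) (h : (genFibΩ p M).toAffine.Nonsingular x y),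
      ∃ h', act σ (Affine.Point.some x y h) = Affine.Point.some (σ • x) (σ • y) h')
    (σ : Field.absoluteGaloisGroup ℚ_[p]) {m : ℕ} {Q : (genFibΩ p M).toAffine.Point}
    (hQ : Q ∈ subfieldPoints (genFibΩ p M) (layer p m).toSubfield coeffs_mem_layer) :
    act σ Q ∈ subfieldPoints (genFibΩ p M) (layer p m).toSubfield coeffs_mem_layer := by
  rcases Q with _ | ⟨x, y, h⟩
  · change act σ 0 ∈ _; rw [hact0]; exact (subfieldPoints _ _ _).zero_mem
  · obtain ⟨h', e⟩ := hact σ x y h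
    obtain ⟨hx, hy⟩ := (some_mem_subfieldPoints_iff _ h).mp hQ
    rw [e, some_mem_subfieldPoints_iff]
    exact ⟨smul_mem_layer σ hx, smul_mem_layer σ hy⟩

omit hE hEt in
/-- `act σ` preserves `E₁` (`σ` is an isometry). [folklore] -/
theorem act_mem_kernel (act : Field.absoluteGaloisGroup ℚ_[p] → (genFibΩ p M).toAffine.Point → (genFibΩ p M).toAffine.Point)
    (hact0 : ∀ σ, act σ 0 = 0)
    (hact : ∀ σ (x y : PadicAlgCl p) (h : (genFibΩ p M).toAffine.Nonsingular x y),
      ∃ h', act σ (Affine.Point.some x y h) = Affine.Point.some (σ • x) (σ • y) h')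
    (σ : Field.absoluteGaloisGroup ℚ_[p]) {Q : (genFibΩ p M).toAffine.Point} (hQ : Q ∈ kernel (Valued.v (R := PadicAlgCl p)) (genFibΩ p M)) :
    act σ Q ∈ kernel (Valued.v (R := PadicAlgCl p)) (genFibΩ p M) := by
  rcases Q with _ | ⟨x, y, h⟩
  · change act σ 0 ∈ _; rw [hact0]; exact (kernel (Valued.v (R := PadicAlgCl p)) (genFibΩ p M)).zero_mem
  · obtain ⟨h', e⟩ := hact σ x y h
    rw [e]
    refine some_mem_kernel _ ?_
    have hx := (some_mem_kernel_iff h).mp hQ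
    rw [Field.absoluteGaloisGroup.smul_def σ x, PadicAlgCl.valuation_def, ← NNReal.coe_lt_coe, coe_nnnorm,
      ← PadicAlgCl.spectralNorm_eq, ← spectralNorm_eq_of_equiv (Field.absoluteGaloisGroup.toAlgEquiv ℚ_[p] σ) x,
      PadicAlgCl.spectralNorm_eq]
    rwa [PadicAlgCl.valuation_def, ← NNReal.coe_lt_coe, coe_nnnorm] at hx

omit hE hEt hintΩ in
/-- **`Λ(act σ Q) = σ • Λ(Q)`** for `‖z Q‖ < 1`. [cite: Kobayashi2003, §8.4] -/
theorem ptLogΩ_act (act : Field.absoluteGaloisGroup ℚ_[p] → (genFibΩ p M).toAffine.Point → (genFibΩ p M).toAffine.Point)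
    (hact0 : ∀ σ, act σ 0 = 0)
    (hact : ∀ σ (x y : PadicAlgCl p) (h : (genFibΩ p M).toAffine.Nonsingular x y),
      ∃ h', act σ (Affine.Point.some x y h) = Affine.Point.some (σ • x) (σ • y) h')
    (σ : Field.absoluteGaloisGroup ℚ_[p]) {Q : (genFibΩ p M).toAffine.Point} (hQ : ‖Q.zCoord‖ < 1) :
    ptLogΩ p M (act σ Q) = σ • ptLogΩ p M Q := by
  show bLogΩ p M (act σ Q).zCoord = σ • bLogΩ p M Q.zCoord
  rw [zCoord_act act hact0 hact, Field.absoluteGaloisGroup.smul_def σ Q.zCoord,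
    Field.absoluteGaloisGroup.smul_def σ (bLogΩ p M Q.zCoord), bLogΩ_algEquiv _ hQ]

omit hE hEt hintΩ in
/-- A point fixed by `stab p m'` (under `act`) has coordinates in `layer m'`. [folklore] -/
theorem mem_subfieldPoints_of_forall_act_eq (act : Field.absoluteGaloisGroup ℚ_[p] → (genFibΩ p M).toAffine.Point → (genFibΩ p M).toAffine.Point)
    (hact : ∀ σ (x y : PadicAlgCl p) (h : (genFibΩ p M).toAffine.Nonsingular x y),
      ∃ h', act σ (Affine.Point.some x y h) = Affine.Point.some (σ • x) (σ • y) h')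
    {m' : ℕ} {Q : (genFibΩ p M).toAffine.Point}
    (h : ∀ σ ∈ stab p m', act σ Q = Q) : Q ∈ subfieldPoints (genFibΩ p M) (layer p m').toSubfield coeffs_mem_layer := by
  rcases Q with _ | ⟨x, y, hxy⟩
  · exact (subfieldPoints _ _ _).zero_mem
  · rw [some_mem_subfieldPoints_iff]
    constructor
    · refine (mem_layer_iff_forall_smul_eq x).mpr fun σ hσ => ?_
      obtain ⟨h', e⟩ := hact σ x y hxy
      have := h σ hσ
      rw [e] at this
      exact (Affine.Point.some.inj this).1
    · refine (mem_layer_iff_forall_smul_eq y).mpr fun σ hσ => ?_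
      obtain ⟨h', e⟩ := hact σ x y hxy
      have := h σ hσ
      rw [e] at this
      exact (Affine.Point.some.inj this).2

omit hEt in
/-- `ΛΩ` of a difference on `L(m) ∩ E₁`. [folklore] -/
theorem ptLogΩ_sub {m : ℕ} {Q₁ Q₂ : (genFibΩ p M).toAffine.Point}
    (h₁ : Q₁ ∈ subfieldPoints (genFibΩ p M) (layer p m).toSubfield coeffs_mem_layer)
    (h₂ : Q₂ ∈ subfieldPoints (genFibΩ p M) (layer p m).toSubfield coeffs_mem_layer)
    (hk₁ : Q₁ ∈ kernel (Valued.v (R := PadicAlgCl p)) (genFibΩ p M)) (hk₂ : Q₂ ∈ kernel (Valued.v (R := PadicAlgCl p)) (genFibΩ p M)) :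
    ptLogΩ p M (Q₁ - Q₂) = ptLogΩ p M Q₁ - ptLogΩ p M Q₂ := by
  haveI := isIntegral_curveK p (LayerField p m) M
  have h := ptLogΩ_add (m := m) ((subfieldPoints _ _ _).sub_mem h₁ h₂) h₂
    ((kernel (Valued.v (R := PadicAlgCl p)) (genFibΩ p M)).sub_mem hk₁ hk₂) hk₂
  rw [sub_add_cancel] at h
  linear_combination -h

omit hEt in
/-- **A point of `L(m) ∩ E₁` whose logarithm lies in `layer m'` lies in `L(m')`** (`m' ≤ m`), provided
`L(m)` has no `p`-power torsion: for `τ ∈ stab m'`, `Λ(act τ Q − Q) = τΛ(Q) − Λ(Q) = 0`, so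
`act τ Q − Q` is `p`-power torsion, hence `0`. [cite: Kobayashi2003, §8.4] -/
theorem mem_subfieldPoints_of_ptLogΩ_mem (act : Field.absoluteGaloisGroup ℚ_[p] → (genFibΩ p M).toAffine.Point → (genFibΩ p M).toAffine.Point)
    (hact0 : ∀ σ, act σ 0 = 0)
    (hact : ∀ σ (x y : PadicAlgCl p) (h : (genFibΩ p M).toAffine.Nonsingular x y),
      ∃ h', act σ (Affine.Point.some x y h) = Affine.Point.some (σ • x) (σ • y) h')
    {m m' : ℕ}
    (htors : ∀ Q ∈ subfieldPoints (genFibΩ p M) (layer p m).toSubfield coeffs_mem_layer, ∀ k : ℕ, p ^ k • Q = 0 → Q = 0)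
    {Q : (genFibΩ p M).toAffine.Point} (hQ : Q ∈ subfieldPoints (genFibΩ p M) (layer p m).toSubfield coeffs_mem_layer)
    (hk : Q ∈ kernel (Valued.v (R := PadicAlgCl p)) (genFibΩ p M)) (hΛ : ptLogΩ p M Q ∈ layer p m') :
    Q ∈ subfieldPoints (genFibΩ p M) (layer p m').toSubfield coeffs_mem_layer := by
  haveI := isIntegral_curveK p (LayerField p m) M
  refine mem_subfieldPoints_of_forall_act_eq act hact fun τ hτ => ?_
  -- `D = act τ Q − Q`
  have hDL : act τ Q - Q ∈ subfieldPoints (genFibΩ p M) (layer p m).toSubfield coeffs_mem_layer :=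
    (subfieldPoints _ _ _).sub_mem (act_mem_subfieldPoints act hact0 hact τ hQ) hQ
  have hDk : act τ Q - Q ∈ kernel (Valued.v (R := PadicAlgCl p)) (genFibΩ p M) :=
    (kernel (Valued.v (R := PadicAlgCl p)) (genFibΩ p M)).sub_mem (act_mem_kernel act hact0 hact τ hk) hk
  have hzQ : ‖Q.zCoord‖ < 1 := by
    have := val_zCoord_lt_one hk
    rwa [PadicAlgCl.valuation_def, ← NNReal.coe_lt_coe, coe_nnnorm, NNReal.coe_one] at this
  have hΛD : ptLogΩ p M (act τ Q - Q) = 0 := by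
    rw [ptLogΩ_sub (m := m) (act_mem_subfieldPoints act hact0 hact τ hQ) hQ (act_mem_kernel act hact0 hact τ hk) hk,
      ptLogΩ_act act hact0 hact τ hzQ, smul_eq_self_of_mem_stab hτ hΛ, sub_self]
  obtain ⟨k, hk0⟩ := exists_pow_smul_eq_zero_of_ptLogΩ_eq_zero (m := m) hDL hDk hΛD
  have hD0 := htors _ hDL k hk0
  exact sub_eq_zero.mp hD0

end BallEval

end Summit.BirchSwinnertonDyer.Rank1Residual.Additive

end
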